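import Literature.MathematicalPhysics.QuantumLattice.HubbardTTPrimeFreeKineticBound
import Literature.MathematicalPhysics.QuantumLattice.HartreeFockFreeFermionTorus
import Literature.MathematicalPhysics.QuantumLattice.FreeFermionSectorEnergyDeviation
import Literature.MathematicalPhysics.QuantumLattice.HubbardNNNHoppingThermodynamicLimit
import Literature.MathematicalPhysics.QuantumLattice.InfVolFermionStateDensity
import HarnessLib

/-!
# The paramagnetic Hartree–Fock CEILING of the `t–t'` Hubbard energy density:
# `e(t, t', U, n) ≤ e(t, t', 0, n) + U (n/2)²`

Family `hubbard` (topic `MathematicalPhysics/QuantumLattice`). The `t' ≠ 0` twin of the tree's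
`Summit.Ventures.CertifiedManyBodySolver.M2.energyDensity2D_le_free_add_interaction` (file
`Rows/HalfFilledTLHartreeFockControl.lean`), assembled from pieces that are all in the tree:

* the plane-wave Slater determinant as a Hartree–Fock trial state of ANY operator
  (`HartreeFock.groundEnergy_le_re_groundStateFunctional`, Bach–Lieb–Solovej (2c.36)) and its value on a
  Hubbard Hamiltonian `hamiltonian G t U` of ANY graph (`HartreeFock.groundStateFunctional_hamiltonian`,
  `hfEnergy_spinBlock`): applied to `hubbardTorusTT' L t t' U = hamiltonian (n.n.) t U + hamiltonian (diag) t' 0`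
  by linearity of the quasi-free state;
* the plane waves diagonalise the diagonal hopping of `(ℤ/Lℤ)²` with levels `4t' cos p₁ cos p₂`
  (`TTPrimeFree.hopMatrix_diag_mul_sitePlaneWave`), so the kinetic energy of the sea `S` in the `t–t'` model
  is `Σ_{k∈S} ε(k)`, `ε(k) = -2t(cos p₁ + cos p₂) - 4t' cos p₁ cos p₂ = TTPrimeFree.ttBand`;
* the Lieb–Loss bathtub lower bound at `U = 0` (`TTPrimeFree.le_groundEnergy_hubbardTorusTT'`), which makes
  the doubly filled Fermi sea the free ground state: `E_{2m}(t, t', 0) = 2 Σ_{k∈S} ε(k)`;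
* the thermodynamic limit along the square tori (`tendsto_energyDensityTT'_torus`, `tendsto_rectN_div_sq`).

Results: §1 `hopMatrix_diag_eq_conjDiag`, `trace_hopMatrix_diag_mul_planeWaveProj` (kinetic energy of a
plane-wave state under the diagonal hopping); §2 `hubbardTorusTT'_groundEnergy_le_freeFermion`
(`E_{|S↑|+|S↓|}(t,t',U) ≤ Σ_{S↑} ε + Σ_{S↓} ε + U |S↑||S↓|/L²`, every real `t, t', U`, `L ≥ 3`),
`hubbardTorusTT'_groundEnergy_le_free_add_interaction` (`E_{2m}(t,t',U) ≤ E_{2m}(t,t',0) + U m²/L²`,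
`U ≥ 0` only through the bathtub); §3 `energyDensityTT'_le_free_add_interaction`
(`e(t,t',U,n) ≤ e(t,t',0,n) + U(n/2)²`, `U ≥ 0`, `0 ≤ n < 2`). The right-hand side's first term is the
free `t–t'` Fermi-sea energy density (the "sharp-sea Slater ceiling" of the certified-bound tables).
Everything is proved; no definitions carrying data beyond §1's abbreviation-free statements; no numerical input.

## References

* V. Bach, E. H. Lieb, J. P. Solovej, J. Stat. Phys. 76 (1994) 3, §2c eq. (2c.36) (Hartree–Fock states
  are variational; plane-wave Slater determinants). [cite: BachLiebSolovej1994, eq. (2c.36)]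
* E. H. Lieb, M. Loss, *Analysis* (2001), §8 / Thm. 1.14 bathtub (the Fermi sea minimises the free
  energy). [cite: LiebLoss1993, §8, Theorem 8.2]
* S. Friedli, Y. Velenik, *Statistical Mechanics of Lattice Systems* (2017), §10.5.2 (plane-wave
  diagonalisation of translation-invariant couplings on the torus). [cite: FriedliVelenikSMLS2017, §10.5.2]
* D. Ruelle, *Statistical Mechanics: Rigorous Results* (1969), §3.3 (thermodynamic limit). [cite: Ruelle1969, §3.3]
-/

noncomputable section

open Matrix Finset Filter Topology

namespace Literature.MathematicalPhysics.QuantumLattice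

namespace TTPrimeFree

open Literature.Probability.LatticeModels LangerMattis HartreeFock ThermodynamicLimit

variable {L : ℕ} [NeZero L]

/-! ### §1 The diagonal hopping in `conjDiag` form and the kinetic energy of a plane-wave state -/

/-- `t' A_diag = W diag(4t' cos p₁ cos p₂) Wᴴ` on `(ℤ/Lℤ)²`, `L ≥ 3`. [cite: FriedliVelenikSMLS2017, §10.5.2] -/
theorem hopMatrix_diag_eq_conjDiag (hL : 3 ≤ L) (t' : ℝ) :
    hopMatrix (fermionTorusDiagGraph L) t' = conjDiag 2 L (fun k => ((siteDiagBand t' k : ℝ) : ℂ)) := by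
  rw [conjDiag, ← hopMatrix_diag_mul_sitePlaneWave hL t', Matrix.mul_assoc,
    sitePlaneWave_mul_conjTranspose, Matrix.mul_one]

/-- **Kinetic energy of the plane-wave state under the diagonal hopping**:
`tr (t' A_diag · P_S) = Σ_{k∈S} 4t' cos p₁(k) cos p₂(k)` (`L ≥ 3`). [cite: FriedliVelenikSMLS2017, §10.5.2] -/
theorem trace_hopMatrix_diag_mul_planeWaveProj (hL : 3 ≤ L) (t' : ℝ) (S : Finset (FermionTorus 2 L)) :
    (hopMatrix (fermionTorusDiagGraph L) t' * planeWaveProj 2 L S).trace =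
      ∑ k ∈ S, ((siteDiagBand t' k : ℝ) : ℂ) := by
  rw [hopMatrix_diag_eq_conjDiag hL, planeWaveProj, conjDiag_mul, trace_conjDiag]
  simp only [Pi.mul_apply, mul_ite, mul_one, mul_zero]
  rw [Finset.sum_ite_mem, Finset.univ_inter]

/-- The plane-wave level of the `t–t'` model in the site-as-momentum variable:
`siteBand (-t) k + siteDiagBand (-t') k = ε(k)`. [cite: XuEtAl2024, eq. (1)] -/
theorem siteBand_add_siteDiagBand (t t' : ℝ) (k : FermionTorus 2 L) :
    siteBand (-t) k + siteDiagBand (-t') k = ttBand L t t' k.toTorusSite := by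
  unfold siteBand siteDiagBand ttBand
  ring

/-! ### §2 Finite tori: the plane-wave Slater determinant in the `t–t'` model -/

/-- **Free-fermion (paramagnetic Hartree–Fock) upper bound for the `t–t'` torus, any filling.** For
`L ≥ 3`, all real `t, t', U` and all momentum sets `S↑, S↓`:
`E_{|S↑|+|S↓|}(t, t', U) ≤ Σ_{k∈S↑} ε(k) + Σ_{k∈S↓} ε(k) + U |S↑| |S↓| / L²` — the energy of the plane-wave
Slater determinant: the quasi-free state of `P = P_{S↑} ⊕ P_{S↓}` bounds `groundEnergy` of ANY operator
(BLS (2c.36)); on `hamiltonian (n.n.) t U` its value is the tree's `hfEnergy` (`Σ siteBand(-t) + U|S↑||S↓|/L²`),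
on `hamiltonian (diag) t' 0` it is `Σ siteDiagBand(-t')` (§1), and the two add up to `Σ ε`.
[cite: BachLiebSolovej1994, eq. (2c.36)] -/
theorem hubbardTorusTT'_groundEnergy_le_freeFermion (hL : 3 ≤ L) (t t' U : ℝ)
    (Sup Sdn : Finset (FermionTorus 2 L)) :
    groundEnergy (hubbardTorusTT' L t t' U) (Sup.card + Sdn.card) ≤
      (∑ k ∈ Sup, ttBand L t t' k.toTorusSite) + (∑ k ∈ Sdn, ttBand L t t' k.toTorusSite) +
        U * (Sup.card * Sdn.card) / (L : ℝ) ^ 2 := by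
  set S : Fin 2 → Finset (FermionTorus 2 L) := fun σ => if σ = 0 then Sup else Sdn with hS
  have h0 : S 0 = Sup := rfl
  have h1 : S 1 = Sdn := rfl
  have hP := isHermitian_freeState S
  have hPP := freeState_mul_self S
  have htr := trace_freeState S
  -- the diagonal-graph Hartree–Fock functional of the free state: kinetic part only (`U = 0`)
  have hdiag : hfEnergy (fermionTorusDiagGraph L) t' 0 (freeState 2 L S) =
      (((∑ k ∈ S 0, siteDiagBand (-t') k) + (∑ k ∈ S 1, siteDiagBand (-t') k) : ℝ) : ℂ) := by
    rw [freeState, hfEnergy_spinBlock, Fin.sum_univ_two, trace_hopMatrix_diag_mul_planeWaveProj hL,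
      trace_hopMatrix_diag_mul_planeWaveProj hL]
    push_cast
    ring
  -- the quasi-free state bounds the ground energy of the full `t–t'` Hamiltonian; evaluate it on both graphs
  have hvar := groundEnergy_le_re_groundStateFunctional hP hPP htr (hubbardTorusTT' L t t' U)
  rw [hubbardTorusTT', map_add, groundStateFunctional_hamiltonian (fermionTorusGraph 2 L) hP hPP t U,
    groundStateFunctional_hamiltonian (fermionTorusDiagGraph L) hP hPP t' 0, hfEnergy_freeState (d := 2) hL t U S,
    hdiag, ← Complex.ofReal_add, Complex.ofReal_re, h0, h1] at hvar
  have hsum : ∀ T : Finset (FermionTorus 2 L), (∑ k ∈ T, siteBand (-t) k) + (∑ k ∈ T, siteDiagBand (-t') k) =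
      ∑ k ∈ T, ttBand L t t' k.toTorusSite := fun T => by
    rw [← Finset.sum_add_distrib]
    exact Finset.sum_congr rfl fun k _ => siteBand_add_siteDiagBand t t' k
  have e1 := hsum Sup
  have e2 := hsum Sdn
  unfold hubbardTorusTT'
  linarith

/-- Fermi-level identity: if `ε ≤ μ` on `S` and `μ ≤ ε` off `S` then
`Σ_k min(ε k - μ, 0) = Σ_{k∈S} ε k - μ |S|`. [folklore] -/
private theorem sum_min_sub_eq_of_fermiLevel' {ι : Type*} [Fintype ι] [DecidableEq ι] (ε : ι → ℝ)
    (μ : ℝ) (S : Finset ι) (hin : ∀ k ∈ S, ε k ≤ μ) (hout : ∀ k ∉ S, μ ≤ ε k) :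
    ∑ k, min (ε k - μ) 0 = ∑ k ∈ S, ε k - μ * S.card := by
  classical
  rw [← Finset.sum_add_sum_compl S]
  have h1 : ∑ k ∈ S, min (ε k - μ) 0 = ∑ k ∈ S, (ε k - μ) :=
    Finset.sum_congr rfl fun k hk => min_eq_left (by linarith [hin k hk])
  have h2 : ∑ k ∈ Sᶜ, min (ε k - μ) 0 = 0 :=
    Finset.sum_eq_zero fun k hk => min_eq_right (by linarith [hout k (Finset.mem_compl.mp hk)])
  rw [h1, h2, add_zero, Finset.sum_sub_distrib, Finset.sum_const, nsmul_eq_mul]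
  ring

/-- **Plane-wave Hartree–Fock at finite volume for the `t–t'` torus.** For `L ≥ 3`, every real
`t, t', U` (no sign condition) and every `m ≤ L²`: `E_{2m}(t, t', U) ≤ E_{2m}(t, t', 0) + U m²/L²` — a Fermi sea `S` of the
`t–t'` band (`exists_fermiSet`) filled with both spins has energy `2 Σ_S ε + U m²/L²`
(`hubbardTorusTT'_groundEnergy_le_freeFermion`) and `2 Σ_S ε ≤ E_{2m}(t, t', 0)` by the bathtub bound at
the Fermi level (`le_groundEnergy_hubbardTorusTT'` at `U = 0`, where its sign hypothesis is trivial; this is the step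
that shows the Fermi sea optimal for the free `t–t'` model). [cite: BachLiebSolovej1994, eq. (2c.36)]
[cite: LiebLoss1993, §8, Theorem 8.2] -/
theorem hubbardTorusTT'_groundEnergy_le_free_add_interaction (hL : 3 ≤ L) (t t' U : ℝ)
    {m : ℕ} (hm : m ≤ Fintype.card (TorusSite 2 L)) :
    groundEnergy (hubbardTorusTT' L t t' U) (2 * m) ≤
      groundEnergy (hubbardTorusTT' L t t' 0) (2 * m) + U * ((m : ℝ) * m) / (L : ℝ) ^ 2 := by
  classical
  obtain ⟨F, eF, hF, hle, hge⟩ := exists_fermiSet (ttBand L t t') hm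
  -- transport the Fermi set to the site-as-momentum index of the plane-wave projections
  set e : TorusSite 2 L ↪ FermionTorus 2 L := FermionTorus.equivTorusSite.symm.toEmbedding with he
  have he' : ∀ z : TorusSite 2 L, (e z).toTorusSite = z := fun z => by
    show (FermionTorus.ofTorusSite z).toTorusSite = z
    exact FermionTorus.toTorusSite_ofTorusSite z
  have hup := hubbardTorusTT'_groundEnergy_le_freeFermion hL t t' U (F.map e) (F.map e)
  rw [Finset.card_map, Finset.sum_map, ← two_mul] at hup
  simp only [he'] at hup
  rw [hF] at hup
  -- the bathtub at `U = 0` at the Fermi level `eF`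
  have hcard : 2 * m ≤ 2 * L ^ 2 := by
    have hc : Fintype.card (TorusSite 2 L) = L ^ 2 := by simp [Fintype.card_pi, ZMod.card]
    omega
  have hlo := le_groundEnergy_hubbardTorusTT' hL t t' le_rfl eF hcard
  rw [sum_min_sub_eq_of_fermiLevel' (ttBand L t t') eF F hle hge, hF] at hlo
  push_cast at hlo
  -- `eF·2m + 2(Σ_F ε - eF m) = 2 Σ_F ε`
  have h2 : 2 * ∑ k ∈ F, ttBand L t t' k ≤ groundEnergy (hubbardTorusTT' L t t' 0) (2 * m) := by linarith
  linarith

/-! ### §3 Thermodynamic limit -/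

/-- **The sharp-sea Hartree–Fock ceiling of the `t–t'` Hubbard energy density.** For `U ≥ 0` and
`0 ≤ n < 2`: `e(t, t', U, n) ≤ e(t, t', 0, n) + U (n/2)²` — §2 along the square tori `L × L` in the sectors
`N_L(n) = 2⌊nL²/2⌋` (`tendsto_energyDensityTT'_torus` at `U` and at `U = 0`, `tendsto_rectN_div_sq`).
[cite: BachLiebSolovej1994, eq. (2c.36)] [cite: Ruelle1969, §3.3] -/
theorem energyDensityTT'_le_free_add_interaction (t t' : ℝ) {U : ℝ} (hU : 0 ≤ U) {n : ℝ}
    (hn0 : 0 ≤ n) (hn2 : n < 2) :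
    energyDensityTT' t t' U n ≤ energyDensityTT' t t' 0 n + U * (n / 2) ^ 2 := by
  set φ : ℕ → ℕ := fun m => m + 3 with hφdef
  have hφ : Tendsto φ atTop atTop :=
    tendsto_atTop_atTop.2 fun b => ⟨b, fun m hm => by simp only [hφdef]; omega⟩
  have limU : Tendsto (fun m => groundEnergy (hubbardTorusTT' (φ m) t t' U) (rectN n (φ m)) /
      ((φ m : ℕ) : ℝ) ^ 2) atTop (𝓝 (energyDensityTT' t t' U n)) :=
    (tendsto_energyDensityTT'_torus t t' hU hn0 hn2).comp hφ
  have lim0 : Tendsto (fun m => groundEnergy (hubbardTorusTT' (φ m) t t' 0) (rectN n (φ m)) /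
      ((φ m : ℕ) : ℝ) ^ 2) atTop (𝓝 (energyDensityTT' t t' 0 n)) :=
    (tendsto_energyDensityTT'_torus t t' le_rfl hn0 hn2).comp hφ
  have limN : Tendsto (fun m => ((rectN n (φ m) : ℕ) : ℝ) / ((φ m : ℕ) : ℝ) ^ 2) atTop (𝓝 n) :=
    (tendsto_rectN_div_sq hn0).comp hφ
  have limI : Tendsto (fun m => U * ((((rectN n (φ m) : ℕ) : ℝ) / ((φ m : ℕ) : ℝ) ^ 2) / 2) ^ 2)
      atTop (𝓝 (U * (n / 2) ^ 2)) :=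
    ((limN.div_const 2).pow 2).const_mul U
  refine le_of_tendsto_of_tendsto' limU (lim0.add limI) fun m => ?_
  have hL3 : 3 ≤ φ m := by simp only [hφdef]; omega
  haveI : NeZero (φ m) := ⟨by omega⟩
  set M : ℕ := ⌊n * ((φ m : ℕ) : ℝ) ^ 2 / 2⌋₊ with hMdef
  have hr : rectN n (φ m) = 2 * M := rfl
  have hM : M ≤ Fintype.card (TorusSite 2 (φ m)) := by
    have h2 : rectN n (φ m) ≤ 2 * (φ m * φ m) := rectN_le_two_mul hn0 hn2.le (φ m)
    rw [hr] at h2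
    have hc : Fintype.card (TorusSite 2 (φ m)) = φ m ^ 2 := by
      rw [Fintype.card_fun, ZMod.card, Fintype.card_fin]
    rw [hc, sq]
    exact Nat.le_of_mul_le_mul_left h2 (by norm_num)
  have key := hubbardTorusTT'_groundEnergy_le_free_add_interaction hL3 t t' U hM
  rw [← hr] at key
  have hL2 : (0 : ℝ) ≤ ((φ m : ℕ) : ℝ) ^ 2 := sq_nonneg _
  have hcast : ((rectN n (φ m) : ℕ) : ℝ) = 2 * (M : ℝ) := by rw [hr]; push_cast; ring
  rw [show U * ((((rectN n (φ m) : ℕ) : ℝ) / ((φ m : ℕ) : ℝ) ^ 2) / 2) ^ 2 =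
      U * ((M : ℝ) * M) / ((φ m : ℕ) : ℝ) ^ 2 / ((φ m : ℕ) : ℝ) ^ 2 by rw [hcast]; ring]
  rw [← add_div]
  exact div_le_div_of_nonneg_right key hL2

/-- Half filling: `e(t, t', U, 1) ≤ e(t, t', 0, 1) + U/4` (`U ≥ 0`). [cite: BachLiebSolovej1994, eq. (2c.36)] -/
theorem energyDensityTT'_one_le_free_add (t t' : ℝ) {U : ℝ} (hU : 0 ≤ U) :
    energyDensityTT' t t' U 1 ≤ energyDensityTT' t t' 0 1 + U / 4 := by
  have h := energyDensityTT'_le_free_add_interaction t t' hU zero_le_one one_lt_two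
  have e : U * ((1 : ℝ) / 2) ^ 2 = U / 4 := by ring
  linarith

/-- **The table form**: a certified UPPER bound `hi` on the FREE `t–t'` energy density at density `n`
(e.g. the sharp Fermi-sea value computed by quadrature with a certified remainder) gives the ceiling
`e(t, t', U, n) ≤ hi + U (n/2)²` at every `U ≥ 0`. [cite: BachLiebSolovej1994, eq. (2c.36)] -/
theorem energyDensityTT'_le_of_free_le (t t' : ℝ) {U : ℝ} (hU : 0 ≤ U) {n hi : ℝ} (hn0 : 0 ≤ n)
    (hn2 : n < 2) (hfree : energyDensityTT' t t' 0 n ≤ hi) :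
    energyDensityTT' t t' U n ≤ hi + U * (n / 2) ^ 2 :=
  (energyDensityTT'_le_free_add_interaction t t' hU hn0 hn2).trans (by linarith)

/-! ### §4 The fully polarised sea: `E_m(t,t',U) ≤ E_{2m}(t,t',0)/2` and `e(t,t',U,n) ≤ e(t,t',0,2n)/2` -/

/-- **The fully polarised Slater determinant at finite volume.** For `L ≥ 3`, every real `t, t', U` and
every `m ≤ L²`: `E_m(t, t', U) ≤ E_{2m}(t, t', 0) / 2` — the `m` plane waves of a Fermi set of the
`t–t'` band filled with ONE spin species (no doubly occupied site, so no `U`-term: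
`hubbardTorusTT'_groundEnergy_le_freeFermion` with the down sea empty) have energy `Σ_F ε`, and
`2 Σ_F ε ≤ E_{2m}(t, t', 0)` by the bathtub bound at the Fermi level (as in
`hubbardTorusTT'_groundEnergy_le_free_add_interaction`). [cite: BachLiebSolovej1994, eq. (2c.36)]
[cite: LiebLoss1993, §8, Theorem 8.2] -/
theorem hubbardTorusTT'_groundEnergy_le_half_free_double (hL : 3 ≤ L) (t t' U : ℝ)
    {m : ℕ} (hm : m ≤ Fintype.card (TorusSite 2 L)) :
    groundEnergy (hubbardTorusTT' L t t' U) m ≤ groundEnergy (hubbardTorusTT' L t t' 0) (2 * m) / 2 := by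
  classical
  obtain ⟨F, eF, hF, hle, hge⟩ := exists_fermiSet (ttBand L t t') hm
  set e : TorusSite 2 L ↪ FermionTorus 2 L := FermionTorus.equivTorusSite.symm.toEmbedding with he
  have he' : ∀ z : TorusSite 2 L, (e z).toTorusSite = z := fun z => by
    show (FermionTorus.ofTorusSite z).toTorusSite = z
    exact FermionTorus.toTorusSite_ofTorusSite z
  -- the one-species Slater determinant over `F`
  have hup := hubbardTorusTT'_groundEnergy_le_freeFermion hL t t' U (F.map e) ∅
  simp only [Finset.card_empty, add_zero, Finset.sum_empty, Nat.cast_zero, mul_zero, zero_div] at hup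
  rw [Finset.card_map, Finset.sum_map] at hup
  simp only [he'] at hup
  rw [hF] at hup
  -- the bathtub at `U = 0` at the Fermi level `eF`, with `2m` particles
  have hcard : 2 * m ≤ 2 * L ^ 2 := by
    have hc : Fintype.card (TorusSite 2 L) = L ^ 2 := by simp [Fintype.card_pi, ZMod.card]
    omega
  have hlo := le_groundEnergy_hubbardTorusTT' hL t t' le_rfl eF hcard
  rw [sum_min_sub_eq_of_fermiLevel' (ttBand L t t') eF F hle hge, hF] at hlo
  push_cast at hlo
  rw [le_div_iff₀ (by norm_num : (0 : ℝ) < 2)]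
  linarith

/-- **The fully polarised bound in the thermodynamic limit: the interacting energy density at density
`n ≤ 1` is at most HALF the FREE energy density at density `2n`, at every `U ≥ 0`.** For rational
`n = p/q` with `p < q`: `e(t, t', U, p/q) ≤ e(t, t', 0, 2p/q) / 2` (§4's finite-volume bound along the
tori `L = 2q(k+2)`, on which both sectors are exact: `N_L(n) = nL²`, `N_L(2n) = 2nL²`). Every certified
CAP on the free `t–t'` energy density at density `2n` (quadrature with certified remainder, grid-cell seas
`energyDensityTT'_le_freeSea_grid` at `U = 0`, …) is therefore a cap on `e(t, t', U, n)` UNIFORM in `U`.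
[cite: BachLiebSolovej1994, eq. (2c.36)] [cite: Ruelle1969, §3.3] -/
theorem energyDensityTT'_le_half_free_double (t t' : ℝ) {U : ℝ} (hU : 0 ≤ U) (p q : ℕ)
    (hq : 0 < q) (hpq : p < q) :
    energyDensityTT' t t' U ((p : ℝ) / q) ≤ energyDensityTT' t t' 0 (2 * (p : ℝ) / q) / 2 := by
  set n : ℝ := (p : ℝ) / q with hn
  have hqr : (0 : ℝ) < q := by exact_mod_cast hq
  have hpq' : (p : ℝ) < q := by exact_mod_cast hpq
  have hn0 : 0 ≤ n := by positivity
  have hn1 : n < 1 := by rw [hn, div_lt_one hqr]; exact hpq'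
  have hn2 : n < 2 := by linarith
  have h2n0 : 0 ≤ 2 * (p : ℝ) / q := by positivity
  have h2n2 : 2 * (p : ℝ) / q < 2 := by
    rw [div_lt_iff₀ hqr]; linarith
  have h2n : 2 * (p : ℝ) / q = 2 * n := by rw [hn]; ring
  -- tori `L_k = q · 2(k + 2)`
  set φ : ℕ → ℕ := fun k => q * (2 * (k + 2)) with hφdef
  have hφ : Tendsto φ atTop atTop := by
    refine tendsto_atTop_atTop.2 fun b => ⟨b, fun k hk => ?_⟩
    calc b ≤ k := hk
      _ ≤ 2 * (k + 2) := by omega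
      _ ≤ q * (2 * (k + 2)) := Nat.le_mul_of_pos_left _ hq
  have limU : Tendsto (fun k => groundEnergy (hubbardTorusTT' (φ k) t t' U) (rectN n (φ k)) /
      ((φ k : ℕ) : ℝ) ^ 2) atTop (𝓝 (energyDensityTT' t t' U n)) :=
    (tendsto_energyDensityTT'_torus t t' hU hn0 hn2).comp hφ
  have lim0 : Tendsto (fun k => groundEnergy (hubbardTorusTT' (φ k) t t' 0) (rectN (2 * (p : ℝ) / q) (φ k)) /
      ((φ k : ℕ) : ℝ) ^ 2 / 2) atTop (𝓝 (energyDensityTT' t t' 0 (2 * (p : ℝ) / q) / 2)) :=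
    ((tendsto_energyDensityTT'_torus t t' le_rfl h2n0 h2n2).comp hφ).div_const 2
  refine le_of_tendsto_of_tendsto' limU lim0 fun k => ?_
  set L : ℕ := q * (2 * (k + 2)) with hLdef
  rw [show φ k = L from rfl]
  haveI : NeZero L := ⟨(Nat.mul_pos hq (by omega : 0 < 2 * (k + 2))).ne'⟩
  have hL3 : 3 ≤ L := le_trans (by omega) (Nat.le_mul_of_pos_left _ hq)
  -- both sectors are exact on these tori
  set K : ℕ := 2 * p * q * (k + 2) ^ 2 with hKdef
  have hN : rectN n L = 2 * K := by
    rw [rectN]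
    have : n * (((L : ℕ)) : ℝ) ^ 2 / 2 = ((K : ℕ) : ℝ) := by
      rw [hn, hKdef, hLdef]; push_cast; field_simp
    rw [this, Nat.floor_natCast]
  have hN2 : rectN (2 * (p : ℝ) / q) L = 2 * (2 * K) := by
    rw [rectN]
    have : 2 * (p : ℝ) / q * (((L : ℕ)) : ℝ) ^ 2 / 2 = ((2 * K : ℕ) : ℝ) := by
      rw [hKdef, hLdef]; push_cast; field_simp
    rw [this, Nat.floor_natCast]
  have hm : 2 * K ≤ Fintype.card (TorusSite 2 L) := by
    have hc : Fintype.card (TorusSite 2 L) = L ^ 2 := by simp [Fintype.card_pi, ZMod.card]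
    rw [hc, hKdef, hLdef]
    have h1 : (p : ℤ) ≤ q := by exact_mod_cast hpq.le
    have h2 : (0 : ℤ) ≤ (q : ℤ) * ((k : ℤ) + 2) ^ 2 := by positivity
    zify
    nlinarith [mul_nonneg (sub_nonneg.2 h1) h2]
  have key := hubbardTorusTT'_groundEnergy_le_half_free_double hL3 t t' U hm
  rw [← hN2, ← hN] at key
  have hL2 : (0 : ℝ) ≤ ((L : ℕ) : ℝ) ^ 2 := sq_nonneg _
  rw [div_div, mul_comm (((L : ℕ) : ℝ) ^ 2) 2, ← div_div]
  exact div_le_div_of_nonneg_right key hL2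

end TTPrimeFree

end Literature.MathematicalPhysics.QuantumLattice

end
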